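import Summits.QuantumFields.YangMills.Theorems.VirialFluxGapFixFrameStd
import Summits.QuantumFields.YangMills.Theorems.VirialFluxGapResolventFieldPointwise
import HarnessLib

/-!
# Route `VirialFluxGap` (YangMills): the UNIT FRAME CURVES of the tree-gauged host `X_fix` and their image in the ring group —
# `embed(x·γ_{(v,a)}(s)) = embed(x)·multiCurve(fixFrameStd (v,a)) s`, so every frame-derivative letter of `Ω_L` serves the «EulerFieldFix» record

Toward the deciding crux `VirialFluxGap.PeriodicSoftness` (item stmt-QuantumFields-24141), resolvent Euler field on the host `X_fix` (memo
`fcl-p3-g40-RESOLVENT-EULER-FIELD-24141-v3.md` §3(d)).  The consumer ✓`TreeGaugeTransfer.periodicSoftness_of_eulerFieldFix` takes curves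
`γ_j : ℝ → X_fix` with `γ_j 0 = 1` and asks for the derivatives of `s ↦ φ_j(x·γ_j s)` and `s ↦ F₀(embed(x·γ_j s))`, where
`embed x = (glue x.1 ∷ x.2.1, x.2.2)`.  The resolvent field is indexed by `ι = FixVar L × Fin 3` and its natural curves are the one-parameter
groups of w2's frame family ✓`fixFrameStd`.  This file builds them and proves the plumbing identities:

* §1 defs `fixRestrict` (ring history ↦ its `X_fix` part: off-tree slice-0 links, later slices, seam) and `fixUnitCurve (v,a) s`
  (`= fixRestrict (multiCurve (fixFrameStd (v,a)) s)`: `exp(s·halfPauli a)` at the variable `v`, `1` elsewhere);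
* §2 `glue_mul`, ★ `fixEmbed_mul` (the embedding is a homomorphism of pointwise groups), `fixEmbed_fixRestrict` (left inverse on comb-gauged
  histories), `multiCurve_fixFrameStd_tree` (the curve keeps the slice-0 tree links at `1`), ★ `fixEmbed_fixUnitCurve`, `fixUnitCurve_zero`,
  ★ `fixEmbed_mul_fixUnitCurve` (`embed(x·γ(s)) = embed x · multiCurve (fixFrameStd va) s`);
* §3 ★★ `hasDerivAt_comp_fixEmbed_fixUnitCurve` (for smooth `f` on the coordinates: `d/ds f(ringCoord(embed(x·γ(s)))) = frameD (fixFrameStd va) f`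
  at the moved point, EVERY `t`) and ★★ `hasDerivAt_ringDeficit_fixEmbed_fixUnitCurve` (`= frameGrad fixFrameStd (ringCoord(embed(x·γ t))) va`) —
  the `HasDerivAt` clauses of «EulerFieldFix» for `Dφ`, `DF` on the whole line (so any `ε₀`).

HONEST LABEL: plumbing; the Euler field is NOT assembled; ⟨24141⟩, ⟨22884⟩ remain OPEN; the Yang–Mills mass gap is NOT proved; no summit is
proved by a line.  DEFINITIONS `fixRestrict`, `fixUnitCurve` + theorems (0 `sorry`), standard axioms.  Explicit-unit seat `ym-line-fcl-p3` g40
(cell ym-idea-1, free hands), `--supports stmt-QuantumFields-24141`.  References: [folklore].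
-/

set_option autoImplicit false

noncomputable section

open scoped Matrix BigOperators ContDiff Topology
open MeasureTheory Set Matrix
open Literature.MathematicalPhysics.QuantumFieldTheory hiding SU2
open Literature.MathematicalPhysics.QuantumLattice
open Literature.MathematicalPhysics.QuantumFieldTheory.SUNBakryEmery (expSU coe_expSU matTop)

namespace Summit.QuantumFields.YangMills.Theorems.VirialFluxGap.FrameHessian

open Summit.QuantumFields.YangMills.Theorems.FemtoTransferGap
open Summit.QuantumFields.YangMills.Theorems.FemtoTransferGap.TT
open Summit.QuantumFields.YangMills.Theorems.VirialFluxGap.RingDeficit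
open Summit.QuantumFields.YangMills.Theorems.VirialFluxGap.FrameDerivative
open Summit.QuantumFields.YangMills.Theorems.VirialFluxGap.FixFrame

variable {L : ℕ} [NeZero L]

open scoped Matrix.Norms.Frobenius

attribute [local instance 2000] Literature.MathematicalPhysics.QuantumFieldTheory.SUNBakryEmery.matTop

/-! ## §1 The restriction to `X_fix` and the unit frame curves -/

omit [NeZero L] in
/-- The `X_fix` part of a ring history: off-tree links of slice `0`, the later slices, the seam. [folklore] -/
def fixRestrict (P : ((Fin (2 * L - 1 + 1) → GaugeConfig 3 L SU2) × (Site 3 L → SU2))) : (OffIdx L → SU2) × ((Fin (2 * L - 1) → GaugeConfig 3 L SU2) × (Site 3 L → SU2)) :=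
  (fun e => P.1 0 e.1, (Fin.tail P.1, P.2))

/-- The UNIT FRAME CURVE of `X_fix` at the index `(v,a)`: `exp(s·halfPauli a)` at the variable `v`, `1` at every other variable. [folklore] -/
def fixUnitCurve (va : FixVar L × Fin 3) (s : ℝ) : (OffIdx L → SU2) × ((Fin (2 * L - 1) → GaugeConfig 3 L SU2) × (Site 3 L → SU2)) :=
  fixRestrict (multiCurve (fixFrameStd va) (fixFrameStd_conjTranspose va) (fixFrameStd_trace va) s)

/-! ## §2 The embedding is a homomorphism; the curves stay comb-gauged -/

omit [NeZero L] in
/-- `glue` is multiplicative. [folklore] -/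
theorem glue_mul (w w' : OffIdx L → SU2) : glue (w * w') = glue w * glue w' := by
  funext e
  rw [Pi.mul_apply]
  by_cases h : treeEdge e = true
  · rw [glue_apply_of_tree _ h, glue_apply_of_tree _ h, glue_apply_of_tree _ h, mul_one]
  · rw [glue_apply_of_not_tree _ h, glue_apply_of_not_tree _ h, glue_apply_of_not_tree _ h, Pi.mul_apply]

omit [NeZero L] in
/-- ★ The tree-gauge embedding `x ↦ (glue x.1 ∷ x.2.1, x.2.2)` is a homomorphism of the pointwise groups. [folklore] -/
theorem fixEmbed_mul (x y : (OffIdx L → SU2) × ((Fin (2 * L - 1) → GaugeConfig 3 L SU2) × (Site 3 L → SU2))) :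
    ((Fin.cons (glue (x * y).1) (x * y).2.1 : Fin (2 * L - 1 + 1) → GaugeConfig 3 L SU2), (x * y).2.2) =
      (((Fin.cons (glue x.1) x.2.1 : Fin (2 * L - 1 + 1) → GaugeConfig 3 L SU2), x.2.2) : ((Fin (2 * L - 1 + 1) → GaugeConfig 3 L SU2) × (Site 3 L → SU2))) *
        ((Fin.cons (glue y.1) y.2.1 : Fin (2 * L - 1 + 1) → GaugeConfig 3 L SU2), y.2.2) := by
  refine Prod.ext ?_ rfl
  show (Fin.cons (glue (x * y).1) (x * y).2.1 : Fin (2 * L - 1 + 1) → GaugeConfig 3 L SU2) =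
    (Fin.cons (glue x.1) x.2.1 : Fin (2 * L - 1 + 1) → GaugeConfig 3 L SU2) * Fin.cons (glue y.1) y.2.1
  funext i
  rw [Pi.mul_apply]
  refine Fin.cases ?_ (fun j => ?_) i
  · simp only [Fin.cons_zero, Prod.fst_mul, glue_mul]
  · simp only [Fin.cons_succ]
    rfl

omit [NeZero L] in
/-- The embedding inverts the restriction on histories whose slice-0 tree links are `1`. [folklore] -/
theorem fixEmbed_fixRestrict (P : ((Fin (2 * L - 1 + 1) → GaugeConfig 3 L SU2) × (Site 3 L → SU2))) (hP : ∀ e : Edge 3 L, treeEdge e = true → P.1 0 e = 1) :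
    ((Fin.cons (glue (fixRestrict P).1) (fixRestrict P).2.1 : Fin (2 * L - 1 + 1) → GaugeConfig 3 L SU2), (fixRestrict P).2.2) = P := by
  refine Prod.ext ?_ rfl
  show (Fin.cons (glue (fixRestrict P).1) (fixRestrict P).2.1 : Fin (2 * L - 1 + 1) → GaugeConfig 3 L SU2) = P.1
  funext i
  refine Fin.cases ?_ (fun j => ?_) i
  · simp only [Fin.cons_zero]
    funext e
    by_cases h : treeEdge e = true
    · rw [glue_apply_of_tree _ h, hP e h]
    · rw [glue_apply_of_not_tree _ h]
      rfl
  · simp only [Fin.cons_succ]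
    rfl

omit [NeZero L] in
/-- The `fixFrameStd` curves keep the slice-0 tree links at `1`. [folklore] -/
theorem multiCurve_fixFrameStd_tree (va : FixVar L × Fin 3) (s : ℝ) {e : Edge 3 L} (he : treeEdge e = true) :
    (multiCurve (fixFrameStd va) (fixFrameStd_conjTranspose va) (fixFrameStd_trace va) s).1 0 e = 1 := by
  have h0 : fixFrameStd va (Sum.inl (0, e)) = 0 := by
    rw [fixFrameStd_apply, if_neg (fun h => fixVar_ne_tree he va.1 h.symm)]
  apply Subtype.ext
  show ((expSU (N := 2) (fixFrameStd_conjTranspose va (Sum.inl (0, e))) (fixFrameStd_trace va (Sum.inl (0, e))) s : SU2) :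
      Matrix (Fin 2) (Fin 2) ℂ) = ((1 : SU2) : Matrix (Fin 2) (Fin 2) ℂ)
  rw [coe_expSU, h0, smul_zero, NormedSpace.exp_zero]
  rfl

omit [NeZero L] in
/-- ★ The image of a unit frame curve in the ring group is the one-slot exponential curve. [folklore] -/
theorem fixEmbed_fixUnitCurve (va : FixVar L × Fin 3) (s : ℝ) :
    ((Fin.cons (glue (fixUnitCurve va s).1) (fixUnitCurve va s).2.1 : Fin (2 * L - 1 + 1) → GaugeConfig 3 L SU2), (fixUnitCurve va s).2.2) =
      multiCurve (fixFrameStd va) (fixFrameStd_conjTranspose va) (fixFrameStd_trace va) s :=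
  fixEmbed_fixRestrict _ fun _ he => multiCurve_fixFrameStd_tree va s he

omit [NeZero L] in
/-- The unit frame curves start at the identity (the clause `γ_j 0 = 1` of «EulerFieldFix»). [folklore] -/
theorem fixUnitCurve_zero (va : FixVar L × Fin 3) : fixUnitCurve (L := L) va 0 = 1 := by
  unfold fixUnitCurve
  rw [multiCurve_zero]
  rfl

omit [NeZero L] in
/-- ★ `embed(x·γ_{va}(s)) = embed(x)·multiCurve(fixFrameStd va) s`. [folklore] -/
theorem fixEmbed_mul_fixUnitCurve (x : (OffIdx L → SU2) × ((Fin (2 * L - 1) → GaugeConfig 3 L SU2) × (Site 3 L → SU2)))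
    (va : FixVar L × Fin 3) (s : ℝ) :
    ((Fin.cons (glue (x * fixUnitCurve va s).1) (x * fixUnitCurve va s).2.1 : Fin (2 * L - 1 + 1) → GaugeConfig 3 L SU2),
        (x * fixUnitCurve va s).2.2) =
      (((Fin.cons (glue x.1) x.2.1 : Fin (2 * L - 1 + 1) → GaugeConfig 3 L SU2), x.2.2) : ((Fin (2 * L - 1 + 1) → GaugeConfig 3 L SU2) × (Site 3 L → SU2))) *
        multiCurve (fixFrameStd va) (fixFrameStd_conjTranspose va) (fixFrameStd_trace va) s := by
  rw [fixEmbed_mul, fixEmbed_fixUnitCurve]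

/-! ## §3 Derivatives along the unit frame curves -/

/-- ★★ **Smooth functions of the coordinates along the unit frame curves** (the `Dφ` clause of «EulerFieldFix», every `t`):
`d/ds f(ringCoord(embed(x·γ_{va}(s))))|_{s=t} = frameD (fixFrameStd va) f (ringCoord(embed(x·γ_{va}(t))))`. [folklore] -/
theorem hasDerivAt_comp_fixEmbed_fixUnitCurve {f : ((Fin (2 * L - 1 + 1) → Edge 3 L → Matrix (Fin 2) (Fin 2) ℂ) × (Site 3 L → Matrix (Fin 2) (Fin 2) ℂ)) → ℝ} (hf : ContDiff ℝ ∞ f)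
    (x : (OffIdx L → SU2) × ((Fin (2 * L - 1) → GaugeConfig 3 L SU2) × (Site 3 L → SU2))) (va : FixVar L × Fin 3) (t : ℝ) :
    HasDerivAt (fun s => f (ringCoord L ((Fin.cons (glue (x * fixUnitCurve va s).1) (x * fixUnitCurve va s).2.1 :
        Fin (2 * L - 1 + 1) → GaugeConfig 3 L SU2), (x * fixUnitCurve va s).2.2)))
      (frameD (fixFrameStd va) f (ringCoord L ((Fin.cons (glue (x * fixUnitCurve va t).1) (x * fixUnitCurve va t).2.1 :
        Fin (2 * L - 1 + 1) → GaugeConfig 3 L SU2), (x * fixUnitCurve va t).2.2))) t := by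
  simp only [fixEmbed_mul_fixUnitCurve]
  exact hasDerivAt_comp_multiCurve hf (fixFrameStd va) (fixFrameStd_conjTranspose va) (fixFrameStd_trace va) _ t

/-- ★★ **The deficit along the unit frame curves** (the `DF` clause of «EulerFieldFix», every `t`):
`d/ds F₀(embed(x·γ_{va}(s)))|_{s=t} = frameGrad fixFrameStd (ringCoord(embed(x·γ_{va}(t)))) va`. [folklore] -/
theorem hasDerivAt_ringDeficit_fixEmbed_fixUnitCurve
    (x : (OffIdx L → SU2) × ((Fin (2 * L - 1) → GaugeConfig 3 L SU2) × (Site 3 L → SU2))) (va : FixVar L × Fin 3) (t : ℝ) :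
    HasDerivAt (fun s => ringDeficit L (fun _ => false) ((Fin.cons (glue (x * fixUnitCurve va s).1) (x * fixUnitCurve va s).2.1 :
        Fin (2 * L - 1 + 1) → GaugeConfig 3 L SU2), (x * fixUnitCurve va s).2.2))
      (frameGrad (L := L) fixFrameStd (ringCoord L ((Fin.cons (glue (x * fixUnitCurve va t).1) (x * fixUnitCurve va t).2.1 :
        Fin (2 * L - 1 + 1) → GaugeConfig 3 L SU2), (x * fixUnitCurve va t).2.2)) va) t := by
  simp only [fixEmbed_mul_fixUnitCurve, frameGrad]
  exact hasDerivAt_ringDeficit_multiCurve (fixFrameStd va) (fixFrameStd_conjTranspose va) (fixFrameStd_trace va) _ t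

end Summit.QuantumFields.YangMills.Theorems.VirialFluxGap.FrameHessian

end
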